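import Summits.CriticalPhenomena.PercolationContinuityZ3.Theorems.PercNearOneGluingNoHeavyLowerTailMajorityGluingQCertSym3TypeZGlue
import HarnessLib

/-!
# Spec-only degree-3 orbit certificates, V: digests built ENTRY BY ENTRY and merged (`digestZ3`) (lane prim-rate, constants-miner 1, gen 38)

Support file for the closed crux `NoHeavyLowerTail` (stmt-CriticalPhenomena-4575), majority-gluing line.  `digestZ2` (…QCertSym3TypeZFast) sorts the WHOLE raw contribution
list of a part with one `msort2`; on the farm that single sort is what limits a part (parts of ≥ 3·10⁵ mksym3z units died with «maximum recursion depth» / 600 s, and the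
15-digest glue of the (12,7) certificate died the same way until it merged instead of sorting — …QCertSym3TypeZGlue: 54 s).  Here the digest is computed PER ENTRY
(`entriesZ2`: one contribution list per multiplier term / slack / row / square; each sorted and aggregated on its own — a few thousand entries at most) and the sorted entry
digests are combined by `mergeAll`: `digestZ3 fuel = aggr (mergeAll (entriesZ2.map (aggr ∘ msort2 fuel)))`.  Soundness: `evalC_digestZ3` (= `evalC` of `toS.contribs3S`,
via `mergeAll_perm`, `msort2_perm`, `evalC_aggr` and `evalC_entriesZ2_flatten`), and the gluing theorem `pos_of_mergedDigestsZ3` (parts state `d.digestZ3 fuel = D`).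
Kernel smoke test `zSmoke3_digestZ3` (`digestZ3 = digestZ2` on the m = 3 smoke part).  No sorries.
-/

namespace Summit.CriticalPhenomena.PercolationContinuityZ3.Theorems

namespace HubOnly
namespace QCert
namespace SymCert3Z

variable (z : SymCert3Z)

/-- The fast contribution lists of a spec part, ONE LIST PER ENTRY. -/
def entriesZ2 : List (List (ℕ × ℤ)) :=
  z.ell2.map z.toS.ell2Y2 ++ z.lin.map z.toS.linY2 ++
    (z.rows.map fun ch => ch.map fun r => z.toS.rowY2 (r.toE z.base.m)).flatten ++ (z.sqs.map fun ch => ch.map z.sqY2).flatten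

/-- **The entry-wise digest**: every entry list sorted and aggregated on its own, the sorted entry digests merged, the merge aggregated. -/
def digestZ3 (fuel : ℕ) : List (ℕ × ℤ) := aggr (mergeAll (z.entriesZ2.map fun l => aggr (msort2 fuel l)))

noncomputable section

/-- Flattening a doubly chunked list of contribution lists. -/
theorem flatten_flatten_map {β : Type} (F : β → List (ℕ × ℤ)) : ∀ L : List (List β),
    (L.map fun ch => ch.map F).flatten.flatten = (L.map fun ch => (ch.map F).flatten).flatten
  | [] => rfl
  | ch :: L => by
    rw [List.map_cons, List.map_cons, List.flatten_cons, List.flatten_cons, List.flatten_append, flatten_flatten_map F L]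

/-- The entry lists flatten to `contribsZ2`. -/
theorem entriesZ2_flatten : z.entriesZ2.flatten = z.contribsZ2 := by
  unfold entriesZ2 contribsZ2
  rw [List.flatten_append, List.flatten_append, List.flatten_append, flatten_flatten_map, flatten_flatten_map]

/-- The entry lists evaluate like `contribsZ2`. -/
theorem evalC_entriesZ2_flatten (val : ℕ → ℝ) : evalC val z.entriesZ2.flatten = evalC val z.contribsZ2 := by
  rw [entriesZ2_flatten]

/-- **The entry-wise digest evaluates like the enumerated contribution list of the translation.** -/
theorem evalC_digestZ3 (hw : z.wfZ = true) (fuel : ℕ) (val : ℕ → ℝ) : evalC val (z.digestZ3 fuel) = evalC val z.toS.contribs3S := by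
  unfold digestZ3
  rw [evalC_aggr, evalC_perm val (mergeAll_perm _), evalC_flatten, List.map_map]
  have h : z.entriesZ2.map (evalC val ∘ fun l => aggr (msort2 fuel l)) = z.entriesZ2.map (evalC val) :=
    List.map_congr_left fun l _ => by
      simp only [Function.comp]
      rw [evalC_aggr, evalC_perm val (msort2_perm fuel _)]
  rw [h, ← evalC_flatten, z.evalC_entriesZ2_flatten, z.evalC_contribsZ2, z.evalC_contribsZ hw]

/-- The parts' enumerated values are their entry-wise digests' values. -/
theorem map_evalC_of_digestsZ3 (fuel : ℕ) (val : ℕ → ℝ) {l : List SymCert3Z} {D : List (List (ℕ × ℤ))}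
    (hw : ∀ d ∈ l, d.wfZ = true) (hD : List.Forall₂ (fun d dg => d.digestZ3 fuel = dg) l D) :
    ((l.map toS).map fun d => evalC val d.contribs3S) = D.map (evalC val) := by
  induction hD with
  | nil => rfl
  | @cons d dg l' D' hdg _ ih =>
    rw [List.map_cons, List.map_cons, List.map_cons, ih fun d' hd' => hw d' (List.mem_cons_of_mem _ hd'), ← hdg, evalC_digestZ3 d (hw d (by simp))]

/-- **NONNEGATIVITY OF A GLUED CERTIFICATE FROM THE PARTS' ENTRY-WISE DIGESTS**, the digests merged (`mergeAll`). -/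
theorem pos_of_mergedDigestsZ3 (b : Cert) (l : List SymCert3Z) (hb : ∀ d ∈ l, d.base = b) (hw : ∀ d ∈ l, d.wfZ = true) (fuel : ℕ)
    (D : List (List (ℕ × ℤ))) (hD : List.Forall₂ (fun d dg => d.digestZ3 fuel = dg) l D) (hruns : runsOK (mergeAll D) = true)
    (val : ℕ → ℝ) (hval : ∀ key, 0 ≤ val key) : 0 ≤ evalC val (SymCert3.concat b (l.map toS)).contribs3S := by
  rw [SymCert3.evalC_concat3 b val (l.map toS) (toS_bases b l hb), map_evalC_of_digestsZ3 fuel val hw hD, ← evalC_flatten]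
  exact evalC_flatten_nonneg_of_mergeAll val hval D hruns

/-- Smoke test (kernel): on the m = 3 smoke part the entry-wise digest IS the fast digest. -/
theorem zSmoke3_digestZ3 : zSmoke3.digestZ3 12 = zSmoke3.digestZ2 12 := by
  decide +kernel

end

end SymCert3Z
end QCert
end HubOnly

end Summit.CriticalPhenomena.PercolationContinuityZ3.Theorems
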